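import Literature.MathematicalPhysics.QuantumFieldTheory.BalabanImbrieJaffe1984to88.BIJ88Sect2Statements

/-!
# `BalabanImbrieJaffe1984to88.BIJ88CovSandwich311` — T. Bałaban, J. Imbrie, A. Jaffe, *Effective action and cluster properties of the
abelian Higgs model*, Commun. Math. Phys. **114** (1988) 257–315 [BalabanImbrieJaffe1988]: Sect. 5.14, p. 311 [PDF 55], the first
display, verbatim with its lead-in: *"To make the replacement of C^{(k)}_{ℤ^d,loc} with C^{(k)}_{loc}, note that the former always
appears between two operators as (I − Q^{s*}Q)C^{(k)}_{ℤ^d,loc}(I − Q*Q^s). This differs from C^{(k)}_{loc} by a small, local operator,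
since after replacing C^{(k)}_{ℤ^d,loc} with C^{(k)}_{ℤ^d}, we have an identity
(I − Q^{s*}Q)C^{(k)}_{ℤ^d}(I − Q*Q^s) = C^{(k)} = C^{(k)}_{loc} + O(e^{−cr(e_k)}).
Thus after removing some O(e^{−cr(e_k)}) remainders, we have our standard covariance C^{(k)}_{loc}."*

PROVED on r18's Sect. 2 vocabulary (`BIJ88Sect2Statements`): the localized covariance **(2.9)** `cLoc Q Qst Qs Qsst C̃ =
(1 − Q^{s*}Q)C̃(1 − Q*Q^s)`, the constraints **(2.10)** `Eq210 Q Qst C : QC = 0 ∧ CQ* = 0` (p. 261: *"C^{(k)}_{loc}, like C^{(k)},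
satisfies the constraints"*), the sharp truncation **(2.8)** `trunc dist R C = C̃^{(k)}` (R = ¼r(e_k)) and the kernel-bound shapes
`Decay` / `Close`:
* `sandwich_eq_self` — the FIRST equality as a ring identity: `QC = 0`, `CQ* = 0` ⟹ `(1 − Q^{s*}Q)C(1 − Q*Q^s) = C`;
* `sandwich_sub_cLoc`, **`self_sub_cLoc`**, `self_eq_cLoc_add` — the SECOND equality with the O-term EXACT: `C − C_loc =
  (1 − Q^{s*}Q)(C − C̃)(1 − Q*Q^s)`, i.e. `C = C_loc + (1 − Q^{s*}Q)(C − C̃)(1 − Q*Q^s)`;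
* `sub_trunc_of_le` / `sub_trunc_of_lt` / **`trunc_close`** — why the middle factor is O(e^{−cr(e_k)}): the far part `C − C̃` vanishes
  within distance R and, under the decay `|C(b,b′)| ≤ ce^{−c dist(b,b′)}` ((2.13)-type), obeys `|C̃(b,b′) − C(b,b′)| ≤
  (c e^{−(c/2)R}) e^{−(c/2)dist(b,b′)}` — with R = ¼r(e_k) the printed `O(e^{−cr(e_k)})` (rate c/8), in the shape `Close` of (2.7)/(2.26).
MODEL READING (stated as such): operators in an arbitrary ring `R` (the identity is algebra), kernels on abstract index types with a
distance (r18's F6-style carriers); the outer factors `(1 − Q^{s*}Q)`, `(1 − Q*Q^s)` are bounded local operators ([2, Chap. 2]) and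
are not given kernels here, so the `O(e^{−cr(e_k)})` is certified for the middle factor `C − C̃` only.

statement-level skeleton of published theorems with citation tags; proofs where landed; nothing here is a claim about the Yang–Mills mass gap

PDF held: `paper:balaban1988-cmp114-bij-abelian-higgs-effective-action` (journal page = PDF page + 256).  Page read as image: PDF p. 55
(journal 311), `g4png.py` ×2 render (seat folder `renders/original-p055-x2.png`).

CITATION HEADER (lean-in-tree rule).  Part of the lit-balaban TYPED SKELETON (HOME `run/shared/lean/pub/lit-balaban/`), Phase 2,
seat p36 (gen 5, unit `lit-balaban-p36`); row **C2.Claim@310** of `HOME/lit-balaban-r16/ROWS-C2-part2.md` (W₆ leaves typed p240155;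
*"𝒫^L_{k+1,loc} extraction identities absent"* — this file types and proves the first of them).  Theorems only; no definitions, no
`Prop` facts; axioms standard.
-/

namespace Literature.MathematicalPhysics.QuantumFieldTheory.BalabanImbrieJaffe1984to88.BIJ88CovSandwich311

open Literature.MathematicalPhysics.QuantumFieldTheory.BalabanImbrieJaffe1984to88.BIJ88Sect2Statements

/-! ## §1 The identity in a ring of operators -/

section RingLevel

variable {R : Type*} [Ring R]

/-- **p. 311, first equality**: if C satisfies the constraints (2.10), `QC = 0` and `CQ* = 0`, then
`(1 − Q^{s*}Q) C (1 − Q*Q^s) = C`. [cite: BalabanImbrieJaffe1988, p.311 (Sect. 5.14)] -/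
theorem sandwich_eq_self {Q Qst Qs Qsst C : R} (h : Eq210 Q Qst C) :
    (1 - Qsst * Q) * C * (1 - Qst * Qs) = C := by
  obtain ⟨hQ, hQst⟩ := h
  have h1 : (1 - Qsst * Q) * C = C := by
    rw [sub_mul, one_mul, mul_assoc, hQ, mul_zero, sub_zero]
  rw [h1, mul_sub, mul_one, ← mul_assoc, hQst, zero_mul, sub_zero]

/-- The sandwich is additive in the middle factor: `(1 − Q^{s*}Q)C(1 − Q*Q^s) − C_loc = (1 − Q^{s*}Q)(C − C̃)(1 − Q*Q^s)` with
`C_loc = (1 − Q^{s*}Q)C̃(1 − Q*Q^s)` of (2.9). [cite: BalabanImbrieJaffe1988, p.311 (Sect. 5.14)] -/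
theorem sandwich_sub_cLoc (Q Qst Qs Qsst C Ct : R) :
    (1 - Qsst * Q) * C * (1 - Qst * Qs) - cLoc Q Qst Qs Qsst Ct = (1 - Qsst * Q) * (C - Ct) * (1 - Qst * Qs) := by
  simp only [cLoc]
  noncomm_ring

/-- **p. 311, second equality with the remainder exact**: under (2.10) for C,
`C − C_loc = (1 − Q^{s*}Q)(C − C̃)(1 − Q*Q^s)` (C̃ the truncation inside C_loc, (2.8)–(2.9)). [cite: BalabanImbrieJaffe1988, p.311 (Sect. 5.14)] -/
theorem self_sub_cLoc {Q Qst Qs Qsst C : R} (h : Eq210 Q Qst C) (Ct : R) :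
    C - cLoc Q Qst Qs Qsst Ct = (1 - Qsst * Q) * (C - Ct) * (1 - Qst * Qs) := by
  rw [← sandwich_sub_cLoc Q Qst Qs Qsst C Ct, sandwich_eq_self h]

/-- … equivalently `C = C_loc + (1 − Q^{s*}Q)(C − C̃)(1 − Q*Q^s)` — the printed `C^{(k)} = C^{(k)}_{loc} + O(e^{−cr(e_k)})` with the
O-term displayed. [cite: BalabanImbrieJaffe1988, p.311 (Sect. 5.14)] -/
theorem self_eq_cLoc_add {Q Qst Qs Qsst C : R} (h : Eq210 Q Qst C) (Ct : R) :
    C = cLoc Q Qst Qs Qsst Ct + (1 - Qsst * Q) * (C - Ct) * (1 - Qst * Qs) := by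
  rw [← self_sub_cLoc h Ct, add_sub_cancel]

/-- The whole printed chain at once: under (2.10) for C, `(1 − Q^{s*}Q)C(1 − Q*Q^s) = C` and `C = C_loc + (1 − Q^{s*}Q)(C − C̃)(1 − Q*Q^s)`.
[cite: BalabanImbrieJaffe1988, p.311 (Sect. 5.14)] -/
theorem identity311 {Q Qst Qs Qsst C : R} (h : Eq210 Q Qst C) (Ct : R) :
    (1 - Qsst * Q) * C * (1 - Qst * Qs) = C ∧
      C = cLoc Q Qst Qs Qsst Ct + (1 - Qsst * Q) * (C - Ct) * (1 - Qst * Qs) :=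
  ⟨sandwich_eq_self h, self_eq_cLoc_add h Ct⟩

end RingLevel

/-! ## §2 The middle factor `C − C̃` is `O(e^{−cr(e_k)})`: kernels -/

section KernelLevel

variable {α β : Type*}

/-- Within the truncation radius the far part vanishes: `dist(a,b) ≤ R ⇒ C(a,b) − C̃(a,b) = 0` ((2.8): C̃ = C there).
[cite: BalabanImbrieJaffe1988, (2.8) p.261] -/
theorem sub_trunc_of_le (dist : α → β → ℝ) (R : ℝ) (K : α → β → ℝ) {a : α} {b : β} (h : dist a b ≤ R) :
    K a b - trunc dist R K a b = 0 := by
  simp [trunc, h]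

/-- Beyond the truncation radius the far part is the kernel itself: `R < dist(a,b) ⇒ C(a,b) − C̃(a,b) = C(a,b)`.
[cite: BalabanImbrieJaffe1988, (2.8) p.261] -/
theorem sub_trunc_of_lt (dist : α → β → ℝ) (R : ℝ) (K : α → β → ℝ) {a : α} {b : β} (h : R < dist a b) :
    K a b - trunc dist R K a b = K a b := by
  have : ¬ dist a b ≤ R := not_le.mpr h
  simp [trunc, this]

/-- **The `O(e^{−cr(e_k)})` of p. 311 for the middle factor.**  If `|C(a,b)| ≤ c e^{−c dist(a,b)}` (c ≥ 0), the sharp truncation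
C̃ = `trunc dist R C` of (2.8) is close to C in the shape of (2.7)/(2.26): `|C̃(a,b) − C(a,b)| ≤ (c e^{−(c/2)R}) e^{−(c/2)dist(a,b)}`
for all a, b — with R = ¼r(e_k) a factor `e^{−(c/8)r(e_k)}` (the sharp analogue of r18's `loc_close`).
[cite: BalabanImbrieJaffe1988, p.311 (Sect. 5.14)] -/
theorem trunc_close {dist : α → β → ℝ} {K : α → β → ℝ} {c : ℝ} (hc : 0 ≤ c) (hK : Decay dist K c) (R : ℝ) :
    Close dist (trunc dist R K) K (c * Real.exp (-(c / 2) * R)) (c / 2) := by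
  intro a b
  by_cases hab : dist a b ≤ R
  · simp only [trunc, hab, if_true, sub_self, abs_zero]
    positivity
  · rw [not_le] at hab
    have : trunc dist R K a b - K a b = -K a b := by simp [trunc, not_le.mpr hab]
    rw [this, abs_neg]
    refine (hK a b).trans ?_
    rw [mul_assoc, ← Real.exp_add]
    gcongr
    nlinarith

/-- The far part in the orientation of §1 (`C − C̃`): the same bound. [cite: BalabanImbrieJaffe1988, p.311 (Sect. 5.14)] -/
theorem abs_sub_trunc_le {dist : α → β → ℝ} {K : α → β → ℝ} {c : ℝ} (hc : 0 ≤ c) (hK : Decay dist K c) (R : ℝ) (a : α) (b : β) :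
    |K a b - trunc dist R K a b| ≤ c * Real.exp (-(c / 2) * R) * Real.exp (-(c / 2) * dist a b) := by
  rw [abs_sub_comm]
  exact trunc_close hc hK R a b

end KernelLevel

end Literature.MathematicalPhysics.QuantumFieldTheory.BalabanImbrieJaffe1984to88.BIJ88CovSandwich311
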